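import Mathlib
import Summits.KontsevichZagierPeriods.Zeta5Search.Brown8.LeadingCoefficientsA
import HarnessLib

/-!
# ζ(5) search — Families: coefficient extraction in the CUBICAL chart of the dual cell equals the gap-coordinate coefficient

HONEST FRAMING: systematic search; no irrationality claim unless certified.  Cell `pub-zeta5`, certifier 2 (cert-2 g10,
2026-08-22).  An identity between integer coefficients of polynomials / power series; nothing about `ζ(5)`; no number of
record moves.

WHAT.  Six consecutive gaps `g₀,…,g₅` of seven real points `0 = p₀ < p₁ < ⋯ < p₆ = 1` (`g_w = p_{w+1} − p_w`); the CUBICAL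
chart at the corolla vertex is `p_k = x_k x_{k+1} ⋯ x₅` (`k = 1,…,5`; variable `i : Fin 5` of this file is `x_{i+1}`), so that
`g₀ = x₁⋯x₅`, `g_w = x_{w+1}⋯x₅ · (1 − x_w)` (`1 ≤ w ≤ 5`) — the chart `z_{η₁} = 0, z_{η_{k+1}} = x_k⋯x₅, z_{η₇} = 1, z_{η₈} = ∞`
in which fam-brown8's census reads off the leading coefficients of the basic cellular families as 4-fold binomial sums
(`Brown8/LeadingCoefficientsA.lean`).  THEOREM (`coeff_chart`): for every `B ∈ ℕ⁶` and every polynomial `P(g)` homogeneous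
of degree `|B|`,

  `[g^B] P = [x^{M(B)}] ( P(g(x)) · ∏_{w=1}^{5} (1 − x_w)^{−(B_w+1)} )`,   `M(B)_k = B₀ + ⋯ + B_{k−1}`,

in `ℤ[[x₁,…,x₅]]`, where `(1 − x)^{−e}` is the inverse power series.  (This is constant-term invariance under the chart: the
`−1` in each exponent is the Jacobian `∏ d log g_w = ± ∏ dx_w / (x_w (1 − x_w))`.)  PROOF: by linearity it suffices to treat
a monomial `g^β`, `|β| = |B|`, whose image is `x^{M(β)} ∏ (1 − x_w)^{β_w}`; the coefficient is then the product of the five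
one-variable coefficients `[x_k^{d_k}] (1 − x_k)^{m_k − 1}`, `m = β − B`, `d_k = −(m₀ + ⋯ + m_{k−1})`, and an `omega` bookkeeping
shows this product vanishes unless `m = 0` (a factor `[x^d](1−x)^{e}` with `0 ≤ e < d` is zero).  The series `(1 − x_w)^{e}`,
`e ∈ ℤ`, are handled through their coefficient function, which is EXACTLY the census file's `Brown8.coeffPow e k = [y^k](1−y)^e`
(`U`, `U_mul_oneSub`).  Used by `Families/CubicalChartLeadPi8v` to identify `Brown8.lead_pi8v` with P2 g6's
`dualConstantTerm` on the diagonal.  Standard axioms only.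
-/

noncomputable section

open MvPowerSeries Finset

namespace Summit.KontsevichZagierPeriods.Zeta5Search.Families.Cellular

namespace CubicalChart

open Summit.KontsevichZagierPeriods.Zeta5Search.Brown8 (coeffPow)

/-! ## The coefficient function `coeffPow e k = [y^k] (1 − y)^e` (`e ∈ ℤ`): closed forms and the Pascal recursion -/

/-- Negative index: zero. -/
theorem coeffPow_of_idx_neg (E k : ℤ) (hk : k < 0) : coeffPow E k = 0 := by
  unfold coeffPow; rw [if_pos hk]

/-- Non-negative exponent: `[y^k](1−y)^e = (−1)^k C(e,k)`. -/
theorem coeffPow_nat_nat (e k : ℕ) : coeffPow e k = (-1) ^ k * (Nat.choose e k : ℤ) := by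
  unfold coeffPow
  rw [if_neg (by omega), if_pos (by omega)]
  simp

/-- Negative exponent: `[y^k](1−y)^{−e−1} = C(e+k,k)`. -/
theorem coeffPow_negSucc_nat (e k : ℕ) : coeffPow (-(e : ℤ) - 1) k = (Nat.choose (e + k) k : ℤ) := by
  unfold coeffPow
  rw [if_neg (by omega), if_neg (by omega)]
  have : (-(-(e : ℤ) - 1) - 1 + (k : ℤ)).toNat = e + k := by omega
  rw [this]
  simp

/-- `[y^0](1−y)^E = 1` for every `E ∈ ℤ`. -/
theorem coeffPow_zero_idx (E : ℤ) : coeffPow E 0 = 1 := by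
  rcases le_or_gt 0 E with h | h
  · obtain ⟨e, rfl⟩ := Int.eq_ofNat_of_zero_le h
    have := coeffPow_nat_nat e 0
    simpa using this
  · obtain ⟨e, he⟩ : ∃ e : ℕ, E = -(e : ℤ) - 1 := ⟨(-E - 1).toNat, by omega⟩
    subst he
    have := coeffPow_negSucc_nat e 0
    simpa using this

/-- Vanishing beyond the degree: `0 ≤ E < k ⇒ [y^k](1−y)^E = 0`. -/
theorem coeffPow_eq_zero_of_lt (E : ℤ) (k : ℕ) (hE : 0 ≤ E) (hk : E < k) : coeffPow E k = 0 := by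
  obtain ⟨e, rfl⟩ := Int.eq_ofNat_of_zero_le hE
  rw [coeffPow_nat_nat, Nat.choose_eq_zero_of_lt (by exact_mod_cast hk)]
  simp

/-- **Pascal recursion** `(1−y)^{E+1} = (1−y)^E (1 − y)` coefficientwise:
`[y^k](1−y)^{E+1} = [y^k](1−y)^E − [y^{k−1}](1−y)^E` (`k ∈ ℕ`, the last term absent for `k = 0`). -/
theorem coeffPow_succ (E : ℤ) (k : ℕ) :
    coeffPow (E + 1) k = coeffPow E k - if 1 ≤ k then coeffPow E ((k : ℤ) - 1) else 0 := by
  rcases Nat.eq_zero_or_pos k with rfl | hk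
  · simp [coeffPow_zero_idx]
  obtain ⟨j, rfl⟩ : ∃ j, k = j + 1 := ⟨k - 1, by omega⟩
  rw [if_pos (by omega)]
  have hj : ((j + 1 : ℕ) : ℤ) - 1 = (j : ℕ) := by push_cast; ring
  rw [hj]
  rcases lt_trichotomy E (-1) with h | h | h
  · -- `E ≤ -2`: `E = -(e+1) - 1`, `E + 1 = -e - 1`
    obtain ⟨e, he⟩ : ∃ e : ℕ, E = -((e + 1 : ℕ) : ℤ) - 1 := ⟨(-E - 2).toNat, by push_cast; omega⟩
    subst he
    have h1 : -((e + 1 : ℕ) : ℤ) - 1 + 1 = -(e : ℤ) - 1 := by push_cast; ring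
    rw [h1, coeffPow_negSucc_nat, coeffPow_negSucc_nat, coeffPow_negSucc_nat]
    have := Nat.choose_succ_succ' (e + j + 1) j
    rw [show e + j + 1 + 1 = e + 1 + (j + 1) by ring, show e + j + 1 = e + 1 + j by ring] at this
    rw [this, show e + (j + 1) = e + 1 + j by ring]
    push_cast; ring
  · -- `E = -1`
    subst h
    rw [show (-1 : ℤ) + 1 = ((0 : ℕ) : ℤ) by norm_num, coeffPow_nat_nat,
      show (-1 : ℤ) = -((0 : ℕ) : ℤ) - 1 by norm_num, coeffPow_negSucc_nat, coeffPow_negSucc_nat]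
    simp
  · -- `E ≥ 0`
    obtain ⟨e, rfl⟩ := Int.eq_ofNat_of_zero_le (show 0 ≤ E by omega)
    rw [show (e : ℤ) + 1 = ((e + 1 : ℕ) : ℤ) by push_cast; ring, coeffPow_nat_nat, coeffPow_nat_nat,
      coeffPow_nat_nat, Nat.choose_succ_succ']
    push_cast; ring

/-! ## The power-series ring of the chart and the series `U(e) = ∏_i (1 − x_i)^{e_i}`, `e ∈ ℤ⁵` -/

/-- `ℤ[[x₁,…,x₅]]` (variable `i : Fin 5` is `x_{i+1}`). -/
abbrev T5 := MvPowerSeries (Fin 5) ℤ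

/-- The variable `x_{i+1}`. -/
abbrev x (i : Fin 5) : T5 := MvPowerSeries.X i

/-- **`U(e) = ∏_{i} (1 − x_i)^{e_i}`** for an INTEGER exponent vector, DEFINED by its coefficients
`[x^d] U(e) = ∏_i [y^{d_i}](1−y)^{e_i} = ∏_i coeffPow e_i d_i` (so negative powers are the inverse power series). -/
def U (e : Fin 5 → ℤ) : T5 := fun d => ∏ i, coeffPow (e i) (d i)

/-- The coefficients of `U(e)`. -/
@[simp] theorem coeff_U (e : Fin 5 → ℤ) (d : Fin 5 →₀ ℕ) : coeff d (U e) = ∏ i, coeffPow (e i) (d i) := rfl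

/-- `U(0) = 1`. -/
theorem U_zero : U 0 = 1 := by
  classical
  ext d
  rw [coeff_U, MvPowerSeries.coeff_one]
  by_cases hd : d = 0
  · subst hd; rw [if_pos rfl]; simp [coeffPow_zero_idx]
  · rw [if_neg hd]
    obtain ⟨i, hi⟩ : ∃ i, d i ≠ 0 := by
      by_contra h; push Not at h; exact hd (Finsupp.ext h)
    apply Finset.prod_eq_zero (Finset.mem_univ i)
    simp only [Pi.zero_apply]
    exact coeffPow_eq_zero_of_lt 0 (d i) le_rfl (by exact_mod_cast Nat.pos_of_ne_zero hi)

/-- **`U(e) · (1 − x_j) = U(e + δ_j)`** (the Pascal recursion in variable `j`). -/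
theorem U_mul_oneSub (e : Fin 5 → ℤ) (j : Fin 5) : U e * (1 - x j) = U (e + Pi.single j 1) := by
  classical
  ext d
  rw [mul_sub, mul_one, map_sub, coeff_U, coeff_U,
    show (x j : T5) = monomial (Finsupp.single j 1) 1 from MvPowerSeries.X_def j, coeff_mul_monomial]
  -- split both products at `j`
  rw [← Finset.mul_prod_erase _ _ (Finset.mem_univ j), ← Finset.mul_prod_erase _ _ (Finset.mem_univ j)]
  have hrest : ∏ i ∈ Finset.univ.erase j, coeffPow ((e + Pi.single j 1 : Fin 5 → ℤ) i) (d i) =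
      ∏ i ∈ Finset.univ.erase j, coeffPow (e i) (d i) := by
    refine Finset.prod_congr rfl fun i hi => ?_
    rw [Finset.mem_erase] at hi
    simp [hi.1]
  rw [hrest]
  simp only [Pi.add_apply, Pi.single_eq_same]
  rw [coeffPow_succ]
  by_cases hk : 1 ≤ d j
  · have hle : Finsupp.single j 1 ≤ d := by rw [Finsupp.single_le_iff]; exact hk
    rw [if_pos hk, if_pos hle, mul_one, coeff_U,
      ← Finset.mul_prod_erase _ _ (Finset.mem_univ j)]
    have hrest' : ∏ i ∈ Finset.univ.erase j, coeffPow (e i) ((d - Finsupp.single j 1 : Fin 5 →₀ ℕ) i) =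
        ∏ i ∈ Finset.univ.erase j, coeffPow (e i) (d i) := by
      refine Finset.prod_congr rfl fun i hi => ?_
      rw [Finset.mem_erase] at hi
      simp [Ne.symm hi.1]
    rw [hrest']
    have hj : (((d - Finsupp.single j 1 : Fin 5 →₀ ℕ) j : ℕ) : ℤ) = (d j : ℤ) - 1 := by
      simp only [Finsupp.coe_tsub, Pi.sub_apply, Finsupp.single_eq_same]
      omega
    rw [hj]; ring
  · have hle : ¬ Finsupp.single j 1 ≤ d := by rw [Finsupp.single_le_iff]; exact hk
    rw [if_neg hk, if_neg hle]; ring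

/-- `U(e) · (1 − x_j)^n = U(e + n δ_j)`. -/
theorem U_mul_oneSub_pow (e : Fin 5 → ℤ) (j : Fin 5) (n : ℕ) :
    U e * (1 - x j) ^ n = U (e + Pi.single j (n : ℤ)) := by
  induction n generalizing e with
  | zero => simp
  | succ n ih =>
    rw [pow_succ, ← mul_assoc, ih, U_mul_oneSub]
    congr 1
    ext i
    by_cases hi : i = j
    · subst hi; simp; ring
    · simp [hi]

/-- `U(e) · ∏_j (1 − x_j)^{n_j} = U(e + n)`. -/
theorem U_mul_prod (e : Fin 5 → ℤ) (n : Fin 5 → ℕ) :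
    U e * ∏ j, (1 - x j) ^ n j = U (fun i => e i + n i) := by
  classical
  have key : ∀ s : Finset (Fin 5), U e * ∏ j ∈ s, (1 - x j) ^ n j = U (fun i => e i + if i ∈ s then (n i : ℤ) else 0) := by
    intro s
    induction s using Finset.induction_on with
    | empty => simp
    | @insert j s hj ih =>
      rw [Finset.prod_insert hj, mul_comm ((1 - x j) ^ n j) _, ← mul_assoc, ih, U_mul_oneSub_pow]
      congr 1
      ext i
      by_cases hi : i = j
      · subst hi; simp [hj]
      · simp [hi, Finset.mem_insert]
  simpa using key Finset.univ

/-! ## The chart -/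

/-- Exponent vector of the monomial `x_w x_{w+1} ⋯ x₅` (`w : Fin 6`; for `w = 0` all five variables, for `w = 5` none):
entry `k` is `[w ≤ k]` (variable `k : Fin 5` being `x_{k+1}`). -/
def tail (w : Fin 6) : Fin 5 →₀ ℕ :=
  Finsupp.equivFunOnFinite.symm fun k => if w.val ≤ k.val then 1 else 0

/-- The entries of `tail`. -/
@[simp] theorem tail_apply (w : Fin 6) (k : Fin 5) : tail w k = if w.val ≤ k.val then 1 else 0 := by
  simp [tail]

/-- The unit factor of the gap `g_w` in the chart: `1` for `w = 0`, `1 − x_w` for `1 ≤ w ≤ 5` (variable `w − 1`). -/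
def unitFac (w : Fin 6) : T5 := Fin.cases 1 (fun j => 1 - x j) w

/-- `unitFac 0 = 1`. -/
@[simp] theorem unitFac_zero : unitFac 0 = 1 := rfl
/-- `unitFac (j+1) = 1 − x_j`. -/
@[simp] theorem unitFac_succ (j : Fin 5) : unitFac j.succ = 1 - x j := rfl
/-- The five non-trivial unit factors, at numerals. -/
theorem unitFac_num : unitFac 1 = 1 - x 0 ∧ unitFac 2 = 1 - x 1 ∧ unitFac 3 = 1 - x 2 ∧ unitFac 4 = 1 - x 3 ∧
    unitFac 5 = 1 - x 4 := ⟨rfl, rfl, rfl, rfl, rfl⟩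

/-- **The cubical chart**: `g_w ↦ x_w⋯x₅ · (1 − x_{w−1})` (`g₀ ↦ x₁⋯x₅`, `g₅ ↦ 1 − x₅`). -/
def gChart (w : Fin 6) : T5 := monomial (tail w) 1 * unitFac w

/-- The chart as a ring homomorphism `ℤ[g₀,…,g₅] → ℤ[[x₁,…,x₅]]`. -/
def chart : MvPolynomial (Fin 6) ℤ →ₐ[ℤ] T5 := MvPolynomial.aeval gChart

/-- `chart (g_w) = gChart w`. -/
@[simp] theorem chart_X (w : Fin 6) : chart (MvPolynomial.X w) = gChart w := by
  simp [chart]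

/-- The monomial exponent `M(β) = Σ_w β_w · tail w`, i.e. `M(β)_k = β₀ + ⋯ + β_k` (variable `k` = `x_{k+1}`). -/
def Mexp (β : Fin 6 →₀ ℕ) : Fin 5 →₀ ℕ := ∑ w, β w • tail w

/-- The entries of `M(β)`. -/
theorem Mexp_apply (β : Fin 6 →₀ ℕ) (k : Fin 5) : Mexp β k = ∑ w : Fin 6, if w.val ≤ k.val then β w else 0 := by
  simp only [Mexp, Finsupp.coe_finsetSum, Finset.sum_apply, Finsupp.coe_smul, Pi.smul_apply, tail_apply,
    smul_eq_mul]
  refine Finset.sum_congr rfl fun w _ => ?_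
  split_ifs <;> simp

/-- **Image of a monomial**: `chart (g^β) = x^{M(β)} · ∏_{j} (1 − x_j)^{β_{j+1}}`. -/
theorem chart_monomial (β : Fin 6 →₀ ℕ) :
    chart (MvPolynomial.monomial β 1) = monomial (Mexp β) 1 * ∏ j : Fin 5, (1 - x j) ^ β j.succ := by
  classical
  rw [chart, MvPolynomial.aeval_monomial, map_one, one_mul, Finsupp.prod_fintype _ _ (fun i => by simp)]
  simp only [gChart, mul_pow, Finset.prod_mul_distrib, monomial_pow, one_pow]
  have h1 : ∏ w : Fin 6, (monomial (β w • tail w)) (1 : ℤ) = (monomial (Mexp β) 1 : T5) := by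
    rw [prod_monomial, Finset.prod_const_one]; rfl
  have h2 : ∏ w : Fin 6, unitFac w ^ β w = ∏ j : Fin 5, (1 - x j) ^ β j.succ := by
    rw [Fin.prod_univ_succ]; simp
  rw [h1, h2]

/-! ## The coefficient of a monomial image: the `omega` bookkeeping -/

/-- One-variable bookkeeping behind CT-invariance: for `m ∈ ℤ⁶` with `Σ m = 0`, the five coefficients
`[x_k^{d_k}](1−x_k)^{m_{k+1} − 1}`, `d_k = −(m₀+⋯+m_k)` (all required `≥ 0`), cannot all be non-zero unless `m = 0`. -/
theorem prod_coeffPow_eq_zero (m : Fin 6 → ℤ) (d : Fin 5 → ℕ) (hsum : ∑ w, m w = 0)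
    (hd : ∀ k : Fin 5, (d k : ℤ) = -∑ w : Fin 6, if w.val ≤ k.val then m w else 0) (hm : m ≠ 0) :
    ∏ k : Fin 5, coeffPow (m k.succ - 1) (d k) = 0 := by
  -- if every factor were non-zero we would get `m = 0`
  by_contra hne
  have hfac : ∀ k : Fin 5, ¬ (0 ≤ m k.succ - 1 ∧ m k.succ - 1 < (d k : ℤ)) := by
    intro k hk
    exact hne (Finset.prod_eq_zero (Finset.mem_univ k) (coeffPow_eq_zero_of_lt _ _ hk.1 hk.2))
  have h0 := hfac 0; have h1 := hfac 1; have h2 := hfac 2; have h3 := hfac 3; have h4 := hfac 4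
  have e0 := hd 0; have e1 := hd 1; have e2 := hd 2; have e3 := hd 3; have e4 := hd 4
  simp only [Fin.sum_univ_six, Fin.isValue] at hsum e0 e1 e2 e3 e4
  simp only [Fin.succ_zero_eq_one, Fin.succ_one_eq_two, Fin.isValue, show (2 : Fin 5).succ = 3 from rfl,
    show (3 : Fin 5).succ = 4 from rfl, show (4 : Fin 5).succ = 5 from rfl] at h0 h1 h2 h3 h4
  simp only [Fin.isValue, Fin.val_zero, Fin.val_one, Fin.val_two, show (3 : Fin 6).val = 3 from rfl,
    show (4 : Fin 6).val = 4 from rfl, show (5 : Fin 6).val = 5 from rfl, show (3 : Fin 5).val = 3 from rfl,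
    show (4 : Fin 5).val = 4 from rfl, le_refl, if_true, zero_le, Nat.one_le_iff_ne_zero] at e0 e1 e2 e3 e4
  norm_num at e0 e1 e2 e3 e4
  apply hm
  have hd0 := (d 0).zero_le; have hd1 := (d 1).zero_le; have hd2 := (d 2).zero_le; have hd3 := (d 3).zero_le
  have hd4 := (d 4).zero_le
  funext w
  fin_cases w <;> simp <;> omega

/-- **Coefficient of a monomial image**: for `|β| = |B|`,
`[x^{M(B)}] ( chart(g^β) · U(−B'−1) ) = [β = B]` (`B' = (B₁,…,B₅)`). -/
theorem coeff_chart_monomial (β : Fin 6 →₀ ℕ) (B : Fin 6 → ℕ) (hdeg : ∑ w, β w = ∑ w, B w) :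
    coeff (Mexp (Finsupp.equivFunOnFinite.symm B))
        (chart (MvPolynomial.monomial β 1) * U (fun i => -(B i.succ : ℤ) - 1)) =
      if β = Finsupp.equivFunOnFinite.symm B then 1 else 0 := by
  classical
  rw [chart_monomial, mul_assoc, mul_comm (∏ j : Fin 5, (1 - x j) ^ β j.succ) (U _), U_mul_prod,
    coeff_monomial_mul]
  by_cases hβ : β = Finsupp.equivFunOnFinite.symm B
  · subst hβ
    rw [if_pos le_rfl, if_pos rfl, tsub_self, one_mul, coeff_U]
    simp [coeffPow_zero_idx]
  · rw [if_neg hβ]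
    split_ifs with hle
    · rw [one_mul, coeff_U]
      -- the omega bookkeeping
      set m : Fin 6 → ℤ := fun w => (β w : ℤ) - B w with hm
      have hm0 : m ≠ 0 := by
        intro h; apply hβ; ext w
        have := congrArg (fun f => f w) h
        simp only [hm, Pi.zero_apply] at this
        simp only [Finsupp.coe_equivFunOnFinite_symm]; omega
      have hsum : ∑ w, m w = 0 := by
        simp only [hm, Finset.sum_sub_distrib]
        have : (∑ w, (β w : ℤ)) = ∑ w, (B w : ℤ) := by exact_mod_cast hdeg
        rw [this]; ring
      have hprod : ∏ k : Fin 5, coeffPow (-(B k.succ : ℤ) - 1 + (β k.succ : ℕ))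
          ((Mexp (Finsupp.equivFunOnFinite.symm B) - Mexp β : Fin 5 →₀ ℕ) k) =
          ∏ k : Fin 5, coeffPow (m k.succ - 1)
            ((fun k => (Mexp (Finsupp.equivFunOnFinite.symm B) - Mexp β : Fin 5 →₀ ℕ) k) k) := by
        refine Finset.prod_congr rfl fun k _ => ?_
        congr 1; simp only [hm]; ring
      rw [hprod]
      apply prod_coeffPow_eq_zero m _ hsum _ hm0
      intro k
      have hk := hle k
      simp only [Finsupp.coe_tsub, Pi.sub_apply]
      rw [Int.ofNat_sub hk]
      simp only [Mexp_apply, Finsupp.coe_equivFunOnFinite_symm, hm]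
      push_cast
      rw [← Finset.sum_sub_distrib, ← Finset.sum_neg_distrib]
      refine Finset.sum_congr rfl fun w _ => ?_
      split_ifs <;> simp
    · rfl

/-! ## The theorem -/

/-- **Constant-term invariance in the cubical chart.**  For `B ∈ ℕ⁶` and `P ∈ ℤ[g₀,…,g₅]` homogeneous of degree `|B|`:
`[g^B] P = [x^{M(B)}] ( chart(P) · ∏_{w=1}^{5} (1 − x_w)^{−(B_w + 1)} )`. -/
theorem coeff_chart (P : MvPolynomial (Fin 6) ℤ) (B : Fin 6 → ℕ) (hP : P.IsHomogeneous (∑ w, B w)) :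
    coeff (Mexp (Finsupp.equivFunOnFinite.symm B)) (chart P * U (fun i => -(B i.succ : ℤ) - 1)) =
      MvPolynomial.coeff (Finsupp.equivFunOnFinite.symm B) P := by
  classical
  conv_lhs => rw [P.as_sum]
  rw [map_sum, Finset.sum_mul, map_sum]
  have hterm : ∀ β ∈ P.support, coeff (Mexp (Finsupp.equivFunOnFinite.symm B))
      (chart (MvPolynomial.monomial β (MvPolynomial.coeff β P)) * U (fun i => -(B i.succ : ℤ) - 1)) =
      if β = Finsupp.equivFunOnFinite.symm B then MvPolynomial.coeff β P else 0 := by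
    intro β hβ
    have hdeg : ∑ w, β w = ∑ w, B w := by
      by_contra hne
      apply (MvPolynomial.mem_support_iff.mp hβ)
      apply hP.coeff_eq_zero
      rwa [Finsupp.degree_eq_sum]
    have hmono : MvPolynomial.monomial β (MvPolynomial.coeff β P) =
        MvPolynomial.C (MvPolynomial.coeff β P) * MvPolynomial.monomial β (1 : ℤ) := by
      rw [MvPolynomial.C_mul_monomial, mul_one]
    rw [hmono, map_mul chart, MvPolynomial.algHom_C, MvPowerSeries.algebraMap_apply, Algebra.algebraMap_self,
      RingHom.id_apply, mul_assoc, MvPowerSeries.coeff_C_mul, coeff_chart_monomial β B hdeg]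
    split_ifs <;> simp
  rw [Finset.sum_congr rfl hterm, Finset.sum_ite_eq']
  split_ifs with h
  · rfl
  · exact (MvPolynomial.notMem_support_iff.mp h).symm

end CubicalChart

end Summit.KontsevichZagierPeriods.Zeta5Search.Families.Cellular
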